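import Literature.NumberTheory.EllipticCurves.LangHeightSmallPoints
import Literature.NumberTheory.EllipticCurves.LangHeightECProofs
import HarnessLib

/-!
# Petsche 2006, Proposition 7 over `ℚ` from the two local estimates; the target from three local facts

Sibling proof file of `LangHeightSmallPoints.lean` (topic `NumberTheory/EllipticCurves`, family
`abc`, G06). It proves

* `Petsche2006_card_smallPoints_le_of`: **Petsche 2006, Proposition 7 over `ℚ`**
  (`Literature.NumberTheory.EllipticCurves.Petsche2006_card_smallPoints_le`) from the two local
  estimates of its printed proof — the non-archimedean estimate
  `Petsche2006_le_finsum_localHeightDiscSum` and the archimedean step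
  `Petsche2006_exists_subset_le_neronLocalHeight_real` — and the local decomposition of the
  canonical height `ĥ = 2(λ_∞ + Σ_p λ_p)` (ATAEC VI.2.1,
  `WeierstrassCurve.Affine.Point.canonicalHeight_eq_two_mul_sum_neronLocalHeight`);
* `szpiro_imp_langHeightLowerBoundConjecture_of_local`: consequently the target fact
  `Literature.NumberTheory.EllipticCurves.szpiro_imp_langHeightLowerBoundConjecture`
  (Szpiro ⇒ Lang's height lower bound over `ℚ`; Hindry–Silverman 1988, Thm. 0.3) conditional on
  exactly these three statements about Néron local heights (via `LangHeightECProofs.lean`: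
  Prop. 7 ⇒ Thm. 2 ⇒ (Szpiro ⇒ Lang)).

## The proof of Proposition 7 over `ℚ` (Petsche 2006, pp. 263–265, with `d = 1`)

Let `S = {P ∈ E(ℚ) | ĥ(P) ≤ log N(𝔇)/(2¹³ 3 σ²)}` (Petsche's `ĥ` is `canonicalHeight/2`); it is
finite by Northcott (`HeightsProofs`). Let `N = q + 1` be the largest integer with
`|S| ≥ 24²(N−1) + 1`, so `|S| ≤ 24² N`, and let `Z ⊆ S` be `N` points with pairwise
`λ_∞(P − Q) ≥ (1/288) max{1, log|j|} ≥ 1/288` (archimedean step). Summing `ĥ(P − Q)` over the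
`N q` ordered pairs of distinct points of `Z`:

* from above, `ĥ(P−Q)/2 ≤ ĥ(P) + ĥ(Q) ≤ 4B` by the parallelogram law (`HeightsProofs`), so the sum of
  the `ĥ/2` is `≤ 4B N²` (Petsche's `Λ(Z) ≤ log N(𝔇)/(2¹¹ 3 σ²)`);
* from below, `ĥ/2 = λ_∞ + Σ_p λ_p` termwise (ATAEC VI.2.1), the archimedean part is `≥ N q/288`
  and the non-archimedean part is `Σ_p N² Λ_p(Z) ≥ N² (1/12)(1/(16σ²) − 1/N) log N(𝔇)` (the sums
  over pairs and over `p` are interchanged using the finiteness of the supports, also part of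
  ATAEC VI.2.1).

Since `ℚ` has a single archimedean place, the loss terms `−log N/(2N) − 197/(60N)` of Petsche's
general argument (Lemma 4 at the other archimedean places) are absent, and the comparison already
forces `N ≤ 2⁹σ²` (Petsche's first case; the case `N > 2⁹σ²` is contradictory outright:
`Petsche2006.false_of_main_ineq`). Hence `|S| ≤ 24² · 2⁹ σ² = 294912 σ² ≤ c₁ σ² log(c₂ σ²)` because
`log(c₂σ²) ≥ log c₂ > 3` (`c₂ = 104613 > e³`) and `3c₁ = 404583`; Petsche's Lemma 6 and the fine
tuning of `c₁, c₂` are not needed over `ℚ` (they are needed for general `k`).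

## Design notes

* Pure proofs (`--kind proof`), no definitions. `σ ≥ 1` (`one_le_szpiroRatio_int`, from
  `N_E ∣ N(𝔇_min)`, Ogg) and the parallelogram inequality for `ℚ`'s decidable equality
  (`canonicalHeight_sub_le_rat`, cf. `canonicalHeight_nsmul_rat` in `LangHeightECProofs.lean`) are
  proved here unconditionally.
* The interchange `Σ_{i∈s} Σᶠ_a = Σᶠ_a Σ_{i∈s}` under finite supports is Mathlib's
  `sum_finsum_comm`.

## References

* C. Petsche, *Small rational points on elliptic curves over number fields*, New York J. Math. 12
  (2006), 257–268; arXiv math/0508160: Proposition 7 and its proof, Theorem 2.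
* M. Hindry, J. H. Silverman, Invent. Math. 93 (1988), 419–450, Thm. 0.3.
* J. H. Silverman, *Advanced Topics in the Arithmetic of Elliptic Curves*, GTM 151 (1994), Thm. VI.2.1.
-/

noncomputable section

open scoped Classical

open IsDedekindDomain

namespace Literature.NumberTheory.EllipticCurves

open WeierstrassCurve WeierstrassCurve.Affine.Point Petsche2006 Rat.HeightOneSpectrum

/-! ### Unconditional facts over `ℚ` used in the proof -/

section Rat

variable {W : WeierstrassCurve ℚ} [W.IsElliptic]

variable (W) in
/-- `σ ≥ 1` for every elliptic curve over `ℚ` (Petsche 2006, §2: "an immediate consequence of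
Ogg's formula is that `η_v ≤ δ_v`, from which we deduce the lower bound `σ ≥ 1`"): if `N > 1` then
`N ∣ N(𝔇_min)` (`WeierstrassCurve.conductorNorm_dvd_minimalDiscriminantNorm`, from `f_v ≤ ord_v Δ_min`)
gives `log N ≤ log N(𝔇_min)`; if `N = 1`, `σ = 1` by convention. [cite: Petsche2006, §2] -/
theorem one_le_szpiroRatio_int : 1 ≤ W.szpiroRatio ℤ := by
  by_cases h1 : 1 < W.conductorNorm ℤ
  · rw [szpiroRatio_of_one_lt_conductorNorm _ _ h1]
    have hDpos : 0 < W.minimalDiscriminantNorm ℤ := minimalDiscriminantNorm_pos_holds W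
    have hdvd : W.conductorNorm ℤ ∣ W.minimalDiscriminantNorm ℤ :=
      conductorNorm_dvd_minimalDiscriminantNorm W
        (finite_setOf_ordMinimalDiscriminant_ne_zero_holds W)
    have hN2 : (2 : ℝ) ≤ (W.conductorNorm ℤ : ℝ) := by exact_mod_cast h1
    have hND : (W.conductorNorm ℤ : ℝ) ≤ (W.minimalDiscriminantNorm ℤ : ℝ) := by
      exact_mod_cast Nat.le_of_dvd hDpos hdvd
    have hlogN : 0 < Real.log (W.conductorNorm ℤ : ℝ) := Real.log_pos (by linarith)
    rw [le_div_iff₀ hlogN, one_mul]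
    exact Real.log_le_log (by linarith) hND
  · push Not at h1
    rw [szpiroRatio_of_conductorNorm_le_one _ _ h1]

/-- `ĥ(P − Q) ≤ 2ĥ(P) + 2ĥ(Q)` over `ℚ`: the parallelogram law (AEC VIII.9.3(a), `HeightsProofs`)
and `ĥ(P + Q) ≥ 0`, for the group law elaborated with `ℚ`'s decidable equality. [folklore] -/
theorem canonicalHeight_sub_le_rat (P Q : W.toAffine.Point) :
    (P - Q).canonicalHeight ≤ 2 * P.canonicalHeight + 2 * Q.canonicalHeight := by
  have h : (P + Q).canonicalHeight + (P - Q).canonicalHeight =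
      2 * P.canonicalHeight + 2 * Q.canonicalHeight := by
    convert parallelogram_law_holds P Q
  have h0 : 0 ≤ (P + Q).canonicalHeight := canonicalHeight_nonneg_holds _
  linarith

/-- `log(c₂ σ²) ≥ 3` for `σ ≥ 1` (`c₂ = 104613 > e³`). [folklore] -/
theorem three_le_log_c₂_mul_sq {σ : ℝ} (hσ : 1 ≤ σ) : 3 ≤ Real.log (c₂ * 1 * σ ^ 2) := by
  have hσ2 : (1 : ℝ) ≤ σ ^ 2 := by nlinarith
  have hc : (0 : ℝ) < c₂ * 1 * σ ^ 2 := by norm_num [c₂]; positivity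
  rw [Real.le_log_iff_exp_le hc]
  have he := Real.exp_one_lt_d9
  have h3 : Real.exp 3 = Real.exp 1 ^ 3 := by rw [← Real.exp_nat_mul]; norm_num
  rw [h3]
  have : Real.exp 1 ^ 3 < (2.7182818286 : ℝ) ^ 3 := by
    gcongr
  have hc0 : (0 : ℝ) ≤ c₂ * 1 := by norm_num [c₂]
  calc Real.exp 1 ^ 3 ≤ (2.7182818286 : ℝ) ^ 3 := this.le
    _ ≤ c₂ * 1 * 1 := by norm_num [c₂]
    _ ≤ c₂ * 1 * σ ^ 2 := by gcongr

end Rat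

/-! ### Proposition 7 over `ℚ` -/

/-- The real-number inequality at the end of Petsche's proof of Proposition 7, specialised to
`k = ℚ`: if `N = q + 1 > 2⁹σ²` points have pairwise archimedean local heights `≥ 1/288` and satisfy
the non-archimedean estimate, the comparison
`N q/288 + N² (1/12)(1/(16σ²) − 1/N) L ≤ N² · 4B`, `4B = L/(2¹¹ 3 σ²)`, is impossible unless
`q = 0` (and `q = 0` contradicts `N > 2⁹σ² ≥ 2⁹`). [folklore] -/
theorem Petsche2006.false_of_main_ineq {σ L Nr q : ℝ} (hσ : 1 ≤ σ) (hL : 0 ≤ L) (hq : 0 ≤ q)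
    (hN : Nr = q + 1) (hlt : 2 ^ 9 * σ ^ 2 < Nr)
    (hmain : Nr * (q * (1 / 288)) + Nr ^ 2 * (1 / 12 * (1 / (16 * σ ^ 2) - 1 / Nr) * L) ≤
      Nr * (Nr * (4 * smallHeightBound 1 σ L))) : False := by
  have hσpos : (0 : ℝ) < σ ^ 2 := by positivity
  have hNrpos : (0 : ℝ) < Nr := by rw [hN]; linarith
  have hB4 : 4 * smallHeightBound 1 σ L = L / (6144 * σ ^ 2) := by
    rw [smallHeightBound]
    ring
  rw [hB4] at hmain
  have h1 : Nr * (q * (1 / 288)) + Nr ^ 2 * (1 / 12 * (1 / (16 * σ ^ 2) - 1 / Nr) * L) =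
      (Nr * q * (6144 * σ ^ 2) + 288 * L * (32 * Nr ^ 2 - 512 * σ ^ 2 * Nr)) /
        (288 * (6144 * σ ^ 2)) := by
    field_simp
    ring
  have h2 : Nr * (Nr * (L / (6144 * σ ^ 2))) = 288 * L * Nr ^ 2 / (288 * (6144 * σ ^ 2)) := by
    field_simp
  rw [h1, h2, div_le_div_iff_of_pos_right (by positivity)] at hmain
  -- `hmain : Nr q 6144σ² + 288 L (32 Nr² − 512 σ² Nr) ≤ 288 L Nr²`
  have hq0 : q = 0 := by
    by_contra hq0
    have hqpos : 0 < q := lt_of_le_of_ne hq (Ne.symm hq0)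
    have hpos : 0 < Nr * q * (6144 * σ ^ 2) := by positivity
    have hLN : 0 ≤ L * Nr := by positivity
    -- `288 L (512σ² Nr − 31 Nr²) = 288 L Nr (512σ² − 31 Nr) ≤ 0`
    have hneg : L * Nr * (512 * σ ^ 2 - 31 * Nr) ≤ 0 :=
      mul_nonpos_of_nonneg_of_nonpos hLN (by linarith)
    nlinarith [hmain, hneg, hpos]
  rw [hq0, zero_add] at hN
  rw [hN] at hlt
  have hσ2 : (1 : ℝ) ≤ σ ^ 2 := by nlinarith
  have h29 : (2 : ℝ) ^ 9 = 512 := by norm_num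
  rw [h29] at hlt
  linarith

/-- The sum estimates of Petsche's proof of Proposition 7 over `ℚ` for a set `Z` of `N = q + 1`
small points (`ĥ/2 ≤ B`) with pairwise archimedean local heights `≥ (1/288) max{1, log|j|}`:
the parallelogram law (`Λ(Z) ≤ 4B`), the local decomposition (ATAEC VI.2.1) and the
non-archimedean estimate give
`N q/288 + N² (1/12)(1/(16σ²) − 1/N) log N(𝔇) ≤ N² · 4B`. [cite: Petsche2006, proof of Prop. 7] -/
theorem Petsche2006.main_ineq_of
    (ha : Petsche2006_le_finsum_localHeightDiscSum)
    (hd : ∀ W : WeierstrassCurve ℚ, canonicalHeight_eq_two_mul_sum_neronLocalHeight W)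
    {W : WeierstrassCurve ℚ} [W.IsElliptic] {B : ℝ} (hB0 : 0 ≤ B) {Z : Finset W.toAffine.Point}
    {q : ℕ} (hZcard : Z.card = q + 1) (hsmallZ : ∀ P ∈ Z, P.canonicalHeight / 2 ≤ B)
    (hZlam : ∀ P ∈ Z, ∀ Q ∈ Z, P ≠ Q →
      1 / 288 * max 1 (Real.log |((W.j : ℚ) : ℝ)|) ≤
        (P - Q).neronLocalHeight Rat.AbsoluteValue.real) :
    (Z.card : ℝ) * ((q : ℝ) * (1 / 288)) +
        (Z.card : ℝ) ^ 2 * (1 / 12 * (1 / (16 * W.szpiroRatio ℤ ^ 2) - 1 / (Z.card : ℝ)) *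
          Real.log (W.minimalDiscriminantNorm ℤ : ℝ)) ≤
      (Z.card : ℝ) * ((Z.card : ℝ) * (4 * B)) := by
  have hZne : Z.Nonempty := by
    rw [← Finset.card_pos, hZcard]
    exact Nat.succ_pos q
  -- upper bound from the parallelogram law
  have hU : ∑ P ∈ Z, ∑ Q ∈ Z.erase P, (P - Q).canonicalHeight ≤
      (Z.card : ℝ) * ((Z.card : ℝ) * (8 * B)) := by
    calc ∑ P ∈ Z, ∑ Q ∈ Z.erase P, (P - Q).canonicalHeight
        ≤ ∑ P ∈ Z, ∑ Q ∈ Z.erase P, 8 * B := by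
          refine Finset.sum_le_sum fun P hP => Finset.sum_le_sum fun Q hQ => ?_
          have hP' := hsmallZ P hP
          have hQ' := hsmallZ Q (Finset.mem_of_mem_erase hQ)
          have := canonicalHeight_sub_le_rat P Q
          linarith
      _ ≤ ∑ P ∈ Z, ∑ Q ∈ Z, 8 * B := by
          refine Finset.sum_le_sum fun P hP => ?_
          exact Finset.sum_le_sum_of_subset_of_nonneg (Finset.erase_subset P Z)
            fun _ _ _ => by positivity
      _ = (Z.card : ℝ) * ((Z.card : ℝ) * (8 * B)) := by
          simp [Finset.sum_const, nsmul_eq_mul]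
  -- local decomposition of each `ĥ(P − Q)`, `P ≠ Q`
  have hne : ∀ P ∈ Z, ∀ Q ∈ Z.erase P, P - Q ≠ 0 := fun P hP Q hQ =>
    sub_ne_zero.mpr (Finset.ne_of_mem_erase hQ).symm
  have hsumD : ∑ P ∈ Z, ∑ Q ∈ Z.erase P, (P - Q).canonicalHeight =
      2 * (∑ P ∈ Z, ∑ Q ∈ Z.erase P, (P - Q).neronLocalHeight Rat.AbsoluteValue.real +
        ∑ P ∈ Z, ∑ Q ∈ Z.erase P,
          ∑ᶠ v : HeightOneSpectrum ℤ, (P - Q).neronLocalHeight (padicAbv v)) := by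
    rw [mul_add, Finset.mul_sum, Finset.mul_sum, ← Finset.sum_add_distrib]
    refine Finset.sum_congr rfl fun P hP => ?_
    rw [Finset.mul_sum, Finset.mul_sum, ← Finset.sum_add_distrib]
    refine Finset.sum_congr rfl fun Q hQ => ?_
    rw [((hd W) (P - Q) (hne P hP Q hQ)).2, mul_add]
  -- archimedean lower bound: each of the `N q` terms is `≥ 1/288`
  have hA : (Z.card : ℝ) * ((q : ℝ) * (1 / 288)) ≤
      ∑ P ∈ Z, ∑ Q ∈ Z.erase P, (P - Q).neronLocalHeight Rat.AbsoluteValue.real := by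
    calc (Z.card : ℝ) * ((q : ℝ) * (1 / 288)) = ∑ P ∈ Z, ∑ Q ∈ Z.erase P, (1 / 288 : ℝ) := by
          rw [Finset.sum_congr rfl fun P hP => by
            rw [Finset.sum_const, nsmul_eq_mul, Finset.card_erase_of_mem hP, hZcard,
              Nat.add_sub_cancel]]
          rw [Finset.sum_const, nsmul_eq_mul]
      _ ≤ ∑ P ∈ Z, ∑ Q ∈ Z.erase P, (P - Q).neronLocalHeight Rat.AbsoluteValue.real := by
          refine Finset.sum_le_sum fun P hP => Finset.sum_le_sum fun Q hQ => ?_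
          have h1 := hZlam P hP Q (Finset.mem_of_mem_erase hQ) (Finset.ne_of_mem_erase hQ).symm
          have h2 : (1 : ℝ) ≤ max 1 (Real.log |((W.j : ℚ) : ℝ)|) := le_max_left _ _
          nlinarith
  -- non-archimedean lower bound: interchange the sums and apply the fact
  have hswap : ∑ P ∈ Z, ∑ Q ∈ Z.erase P,
        ∑ᶠ v : HeightOneSpectrum ℤ, (P - Q).neronLocalHeight (padicAbv v) =
      ∑ᶠ v : HeightOneSpectrum ℤ,
        ∑ P ∈ Z, ∑ Q ∈ Z.erase P, (P - Q).neronLocalHeight (padicAbv v) := by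
    have h1 := sum_finsum_comm (Z.sigma fun P => Z.erase P)
      (fun (x : Σ _ : W.toAffine.Point, W.toAffine.Point) (v : HeightOneSpectrum ℤ) =>
        (x.1 - x.2).neronLocalHeight (padicAbv v)) fun x hx => by
          rw [Finset.mem_sigma] at hx
          exact ((hd W) (x.1 - x.2) (hne x.1 hx.1 x.2 hx.2)).1
    rw [Finset.sum_sigma' Z fun P => Z.erase P, h1]
    exact finsum_congr fun v =>
      (Finset.sum_sigma' Z (fun P => Z.erase P) fun P Q => (P - Q).neronLocalHeight (padicAbv v)).symm
  have hNA : (Z.card : ℝ) ^ 2 * (1 / 12 * (1 / (16 * W.szpiroRatio ℤ ^ 2) - 1 / (Z.card : ℝ)) *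
        Real.log (W.minimalDiscriminantNorm ℤ : ℝ)) ≤
      ∑ P ∈ Z, ∑ Q ∈ Z.erase P,
        ∑ᶠ v : HeightOneSpectrum ℤ, (P - Q).neronLocalHeight (padicAbv v) := by
    rw [hswap]
    calc (Z.card : ℝ) ^ 2 * (1 / 12 * (1 / (16 * W.szpiroRatio ℤ ^ 2) - 1 / (Z.card : ℝ)) *
          Real.log (W.minimalDiscriminantNorm ℤ : ℝ))
        ≤ (Z.card : ℝ) ^ 2 * ∑ᶠ v : HeightOneSpectrum ℤ, localHeightDiscSum (padicAbv v) Z := by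
          gcongr
          exact ha W Z hZne
      _ = ∑ᶠ v : HeightOneSpectrum ℤ, (Z.card : ℝ) ^ 2 * localHeightDiscSum (padicAbv v) Z :=
          mul_finsum _ _
      _ = _ := finsum_congr fun v => card_sq_mul_localHeightDiscSum (padicAbv v) hZne
  linarith [hU, hsumD, hA, hNA]

/-- **Petsche 2006, Proposition 7 over `ℚ`**, from the non-archimedean estimate
(`Petsche2006_le_finsum_localHeightDiscSum`), the archimedean step
(`Petsche2006_exists_subset_le_neronLocalHeight_real`) and the local decomposition
`ĥ = 2(λ_∞ + Σ_p λ_p)` (ATAEC VI.2.1, `canonicalHeight_eq_two_mul_sum_neronLocalHeight`), following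
the printed proof (pp. 263–265) with `d = 1`: let `S` be the set of small points (finite by
Northcott), `N` the largest integer with `|S| ≥ 24²(N−1)+1`, `Z ⊆ S` the `N` points given by the
archimedean step; the height–discriminant sum `Λ(Z)` is `≤ log N(𝔇)/(2¹¹ 3 σ²)` by the parallelogram
law and `≥ (N−1)/(288N) + (1/12)(1/(16σ²) − 1/N) log N(𝔇)` by the local estimates. Over `ℚ` there
is a single archimedean place, so the loss terms of Lemma 4 are absent and the comparison forces
`N ≤ 2⁹σ²` directly (Petsche's case "`N ≤ 2⁹σ²`"), whence `|S| ≤ 24² N ≤ 2⁹ 24² σ² ≤ c₁σ² log(c₂σ²)`;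
in particular Lemma 6 is not needed over `ℚ`. [cite: Petsche2006, Prop. 7] -/
theorem Petsche2006_card_smallPoints_le_of
    (ha : Petsche2006_le_finsum_localHeightDiscSum)
    (hb : Petsche2006_exists_subset_le_neronLocalHeight_real)
    (hd : ∀ W : WeierstrassCurve ℚ, canonicalHeight_eq_two_mul_sum_neronLocalHeight W) :
    Petsche2006_card_smallPoints_le := by
  intro W _
  set σ := W.szpiroRatio ℤ with hσ
  set L := Real.log (W.minimalDiscriminantNorm ℤ : ℝ) with hL
  set B := smallHeightBound 1 σ L with hB
  set S := {P : W.toAffine.Point | P.canonicalHeight / 2 ≤ B} with hS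
  have hσ1 : 1 ≤ σ := one_le_szpiroRatio_int W
  have hL0 : 0 ≤ L := Real.log_nonneg (by exact_mod_cast minimalDiscriminantNorm_pos_holds W)
  have hB0 : 0 ≤ B := by
    rw [hB, smallHeightBound]
    positivity
  -- Northcott: `S` is finite
  have hSfin : S.Finite := by
    have hN := finite_setOf_canonicalHeight_le_of
      exists_abs_canonicalHeight_sub_naiveHeight_le_holds finite_setOf_naiveHeight_le_holds (W := W)
    have hS' : S = {P : W.toAffine.Point | P.canonicalHeight ≤ 2 * B} := by
      ext P
      simp only [hS, Set.mem_setOf_eq]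
      constructor <;> intro h <;> linarith
    rw [hS']
    exact hN (2 * B)
  refine ⟨hSfin, ?_⟩
  -- `n = |S| ≥ 1` (`O ∈ S`), `N = q + 1` the largest integer with `|S| ≥ 24²(N-1) + 1`
  have hn1 : 1 ≤ S.ncard := by
    rw [Nat.one_le_iff_ne_zero, ← Nat.pos_iff_ne_zero, Set.ncard_pos hSfin]
    exact ⟨0, by simp [hS, hB0]⟩
  obtain ⟨q, hq1, hnq⟩ : ∃ q : ℕ, 576 * q + 1 ≤ S.ncard ∧ S.ncard ≤ 576 * (q + 1) :=
    ⟨(S.ncard - 1) / 576, by omega, by omega⟩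
  have hq1' : 24 ^ 2 * q + 1 ≤ hSfin.toFinset.card := by
    rw [← Set.ncard_eq_toFinset_card S hSfin]
    exact hq1
  obtain ⟨Z, hZS, hZcard, hZlam⟩ := hb W hSfin.toFinset q hq1'
  have hsmallZ : ∀ P ∈ Z, P.canonicalHeight / 2 ≤ B := fun P hP => by
    have := hZS hP
    rw [Set.Finite.mem_toFinset] at this
    exact this
  -- the key bound `N ≤ 2⁹ σ²`
  have hN : (q : ℝ) + 1 ≤ 2 ^ 9 * σ ^ 2 := by
    by_contra hlt
    push Not at hlt
    have hmain := main_ineq_of ha hd hB0 hZcard hsmallZ hZlam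
    have hNr : (Z.card : ℝ) = (q : ℝ) + 1 := by rw [hZcard]; push_cast; ring
    rw [hNr] at hmain
    exact false_of_main_ineq hσ1 hL0 (Nat.cast_nonneg q) rfl hlt hmain
  -- conclusion: `|S| ≤ 24² N ≤ 24² 2⁹ σ² ≤ c₁ σ² log(c₂ σ²)`
  have h1 : (S.ncard : ℝ) ≤ 576 * ((q : ℝ) + 1) := by exact_mod_cast hnq
  have h3 := three_le_log_c₂_mul_sq hσ1
  have hσ2 : (0 : ℝ) ≤ σ ^ 2 := by positivity
  have hc₁ : (294912 : ℝ) ≤ c₁ * 3 := by norm_num [c₁]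
  calc (S.ncard : ℝ) ≤ 576 * (2 ^ 9 * σ ^ 2) := h1.trans (by gcongr)
    _ = 294912 * σ ^ 2 := by ring
    _ ≤ c₁ * 3 * σ ^ 2 := by gcongr
    _ ≤ c₁ * Real.log (c₂ * 1 * σ ^ 2) * σ ^ 2 := by
        gcongr
        norm_num [c₁]
    _ = countBound 1 σ := by rw [countBound]; ring

/-- **Szpiro ⇒ Lang over `ℚ`** (`szpiro_imp_langHeightLowerBoundConjecture`; Hindry–Silverman
1988, Thm. 0.3 with the remark after Conj. 0.4), conditional on exactly three statements about
Néron local heights: Petsche's non-archimedean estimate (`Petsche2006_le_finsum_localHeightDiscSum`),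
the archimedean step (`Petsche2006_exists_subset_le_neronLocalHeight_real`) and the local
decomposition of `ĥ` (ATAEC VI.2.1, `canonicalHeight_eq_two_mul_sum_neronLocalHeight`); the rest
of the printed proof (Prop. 7 ⇒ Thm. 2 ⇒ (Szpiro ⇒ Lang)) is proved in this file and in
`LangHeightECProofs.lean`. [cite: Petsche2006, Thm. 2] -/
theorem szpiro_imp_langHeightLowerBoundConjecture_of_local
    (ha : Petsche2006_le_finsum_localHeightDiscSum)
    (hb : Petsche2006_exists_subset_le_neronLocalHeight_real)
    (hd : ∀ W : WeierstrassCurve ℚ, canonicalHeight_eq_two_mul_sum_neronLocalHeight W) :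
    szpiro_imp_langHeightLowerBoundConjecture :=
  szpiro_imp_langHeightLowerBoundConjecture_of_card_smallPoints_le
    (Petsche2006_card_smallPoints_le_of ha hb hd)

end Literature.NumberTheory.EllipticCurves

end
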